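import Summits.NavierStokesRegularity.NavierStokesRegularity.Theses.GaldiLiouvilleGate
import Summits.NavierStokesRegularity.NavierStokesRegularity.Theorems.AdaptedFrequencyFrequencyRigidityOfLiouville
import Summits.NavierStokesRegularity.NavierStokesRegularity.Theorems.GaldiLiouvilleGateParabolicGaldiLiouvilleStubSobolevSixFrobenius
import Literature.Analysis.FluidPDE.SteadyNSSolution
import Literature.Analysis.FluidPDE.ClassicalSolution
import HarnessLib

/-!
# Crux `ParabolicGaldiLiouville` (stmt-NavierStokesRegularity-0893), line `birth`: the crux and
# its open stub `stub_finiteDissipation` both contain Galdi's Liouville problem (crux 0895)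

Helper file of the line lead (`--supports stmt-NavierStokesRegularity-0893`; theorems only).

The birth line of the crux X2 = `GaldiLiouvilleGate.ParabolicGaldiLiouville` ("a smooth bounded
ancient mild Navier–Stokes solution on `ℝ³ × (−∞,0)` with uniformly bounded enstrophy and `L⁶`
slices is `≡ 0`") is down to ONE registered stub, `stub_finiteDissipation` (total dissipation
`∫_{s<0} ∫ |∇v|² < ∞` in the class of X2); the analytic stubs 2a/2b are landed. This file records,
in Lean, WHY that stub is crux-sized: the STEADY case of the X2 class is exactly Leray's class of
`D`-solutions tending to `0` at infinity, so both X2 and the stub imply the route's crux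
`GaldiLiouvilleGate.GaldiLiouville` (stmt-NavierStokesRegularity-0895, Leray's Liouville problem,
open since 1933).

* `Tightness.eLpNorm_six_le_of_tendsto_cocompact` — the Sobolev inequality `‖U‖₆ ≤ K (∫|∇U|_F²)^{1/2}`
  for `C¹` fields `U : ℝ³ → ℝ³` with `U → 0` at infinity (range truncation as in the landed stub
  2a, but the truncations are now COMPACTLY supported, so no integrability of `U` is assumed);
  hence a `D`-solution tending to `0` has `L⁶` slices.
* `Tightness.steady_hypotheses` — a smooth steady solution `(W, Q)` of Navier–Stokes with `ν = 1`,
  finite Dirichlet integral and `W → 0` at infinity, viewed as the time-independent field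
  `fun _ => W`, satisfies ALL FOUR hypotheses of X2: it is a bounded ancient mild solution
  (tree bridge `isBoundedAncientMildSolution_of_classical_bounded`), smooth on `(−∞,0) × ℝ³`, of
  constant (hence uniformly bounded) enstrophy, with `L⁶` slices.
* `galdiLiouville_of_parabolicGaldiLiouville : ParabolicGaldiLiouville → GaldiLiouville` — the
  route's containment "X2 ⊇ X_G" (viscosity normalised to `1` by `U ↦ ν⁻¹U`, `P ↦ ν⁻²P`).
* `galdiLiouville_of_finiteDissipation : (statement of stub_finiteDissipation) → GaldiLiouville` —
  the open stub of the line ALSO contains Leray's problem: for a steady field the total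
  dissipation is `(+∞) · ∫|∇W|²`, finite only if `∇W ≡ 0`, i.e. `W` is constant, i.e. `W = 0`.

No sorry, standard axioms; nothing here is conditional.
-/

noncomputable section

set_option linter.dupNamespace false

namespace Summit.NavierStokesRegularity.NavierStokesRegularity.Theorems.ParabolicGaldiLiouville.Birth

open MeasureTheory Filter Topology Set Function Module Metric
open scoped ENNReal NNReal Laplacian
open Literature.Analysis.FluidPDE

namespace Tightness

/-! ### Sobolev `Ḣ¹ ⊂ L⁶` for fields tending to zero at infinity -/

/-- **Range cut-off vanishing on the unit ball.** On a finite-dimensional real inner product space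
`V` there is a `C¹` map `ψ : V → V` with globally bounded derivative, `ψ w = 0` for `‖w‖ ≤ 1`,
`‖ψ w‖ ≤ ‖w‖³`, and `ψ w = w` for `‖w‖² ≥ 2` (`ψ w = smoothTransition (‖w‖² - 1) • w`; same map as
`SobolevSix.exists_rangeCutoff`, with the vanishing clause exported). -/
theorem exists_rangeCutoff_zero (V : Type*) [NormedAddCommGroup V] [InnerProductSpace ℝ V]
    [FiniteDimensional ℝ V] :
    ∃ (ψ : V → V) (L : ℝ), ContDiff ℝ 1 ψ ∧ (∀ w, ‖fderiv ℝ ψ w‖ ≤ L) ∧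
      (∀ w, ‖w‖ ≤ 1 → ψ w = 0) ∧ (∀ w, ‖ψ w‖ ≤ ‖w‖ ^ 3) ∧ (∀ w, 2 ≤ ‖w‖ ^ 2 → ψ w = w) := by
  set ψ : V → V := fun w => Real.smoothTransition (‖w‖ ^ 2 - 1) • w with hψdef
  have hψ : ContDiff ℝ 1 ψ :=
    (Real.smoothTransition.contDiff.comp ((contDiff_norm_sq ℝ).sub contDiff_const)).smul
      contDiff_id
  have hid : ∀ w : V, 2 ≤ ‖w‖ ^ 2 → ψ w = w := fun w hw => by
    simp only [hψdef]
    rw [Real.smoothTransition.one_of_one_le (by linarith), one_smul]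
  have hzero : ∀ w : V, ‖w‖ ≤ 1 → ψ w = 0 := fun w hw => by
    simp only [hψdef]
    have h1 : ‖w‖ ^ 2 ≤ 1 := by nlinarith [norm_nonneg w]
    rw [Real.smoothTransition.zero_of_nonpos (by linarith), zero_smul]
  have hcont : Continuous (fderiv ℝ ψ) := hψ.continuous_fderiv one_ne_zero
  obtain ⟨C, hC⟩ :=
    (isCompact_closedBall (0 : V) 2).exists_bound_of_continuousOn hcont.continuousOn
  refine ⟨ψ, max C 1, hψ, fun w => ?_, hzero, fun w => ?_, hid⟩
  · rcases le_or_gt ‖w‖ 2 with hw | hw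
    · exact (hC w (mem_closedBall_zero_iff.2 hw)).trans (le_max_left _ _)
    · have hev : ψ =ᶠ[𝓝 w] fun w' => w' := by
        filter_upwards [(isOpen_lt continuous_const continuous_norm).mem_nhds hw] with w' hw'
        exact hid w' (by nlinarith [norm_nonneg w', hw'.le])
      rw [hev.fderiv_eq, fderiv_fun_id]
      exact ContinuousLinearMap.norm_id_le.trans (le_max_right _ _)
  · change ‖Real.smoothTransition (‖w‖ ^ 2 - 1) • w‖ ≤ ‖w‖ ^ 3
    rw [norm_smul, Real.norm_of_nonneg (Real.smoothTransition.nonneg _)]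
    rcases le_or_gt (‖w‖ ^ 2) 1 with hw | hw
    · rw [Real.smoothTransition.zero_of_nonpos (by linarith), zero_mul]
      positivity
    · have h1 : 1 ≤ ‖w‖ := by nlinarith [norm_nonneg w]
      calc Real.smoothTransition (‖w‖ ^ 2 - 1) * ‖w‖ ≤ 1 * ‖w‖ := by
            gcongr
            exact Real.smoothTransition.le_one _
        _ ≤ ‖w‖ ^ 3 := by
            rw [one_mul]
            exact le_self_pow₀ h1 three_ne_zero

/-- A continuous field tending to `0` at infinity is bounded. -/
theorem exists_norm_le_of_tendsto_cocompact {X V : Type*} [TopologicalSpace X]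
    [NormedAddCommGroup V] {U : X → V} (hc : Continuous U)
    (h0 : Tendsto U (cocompact X) (𝓝 0)) : ∃ C : ℝ, ∀ x, ‖U x‖ ≤ C := by
  have h1 : ∀ᶠ x in cocompact X, ‖U x‖ < 1 := by
    have := h0.norm
    rw [norm_zero] at this
    exact (tendsto_order.1 this).2 1 one_pos
  obtain ⟨t, ht, hts⟩ := mem_cocompact.1 h1
  obtain ⟨C, hC⟩ := ht.exists_bound_of_continuousOn hc.continuousOn
  refine ⟨max C 1, fun x => ?_⟩
  by_cases hx : x ∈ t
  · exact (hC x hx).trans (le_max_left _ _)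
  · exact (le_of_lt (hts hx)).trans (le_max_right _ _)

/-- **Sobolev `Ḣ¹(ℝ³) ⊂ L⁶(ℝ³)` for `C¹` fields tending to `0` at infinity, Frobenius form.** There
is `K` such that every `C¹` field `U : ℝ³ → ℝ³` with `U → 0` at infinity satisfies
`‖U‖_{L⁶} ≤ K (∫ |∇U|_F²)^{1/2}` (range truncations `U_n = (n+1)⁻¹ ψ((n+1) U)` are `C¹` and
COMPACTLY SUPPORTED because `U → 0`; the tree's `eLpNorm_six_le_eLpNorm_fderiv_two`,
`‖DU_n‖ ≤ L ‖DU‖`, Fatou in `L⁶`, `‖L‖² ≤ |L|_F²`). This is the classical fact that Leray's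
`D`-solutions tending to `0` lie in `L⁶` (Galdi 2011, Thm. II.6.1). -/
theorem eLpNorm_six_le_of_tendsto_cocompact :
    ∃ K : NNReal, ∀ U : EuclideanSpace ℝ (Fin 3) → EuclideanSpace ℝ (Fin 3),
      ContDiff ℝ 1 U → Tendsto U (cocompact (EuclideanSpace ℝ (Fin 3))) (𝓝 0) →
      eLpNorm U 6 volume ≤
        (K : ENNReal) * (∫⁻ y, ENNReal.ofReal (frobeniusNormSq (fderiv ℝ U y))) ^ (1 / 2 : ℝ) := by
  obtain ⟨ψ, L, hψ, hDψ, hψ0, hψ3, hψid⟩ := exists_rangeCutoff_zero (EuclideanSpace ℝ (Fin 3))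
  set K₀ : ℝ≥0 := SNormLESNormFDerivOfEqConst (EuclideanSpace ℝ (Fin 3))
    (volume : Measure (EuclideanSpace ℝ (Fin 3))) 2 with hK₀
  refine ⟨K₀ * L.toNNReal, fun U hU hU0 => ?_⟩
  set un : ℕ → EuclideanSpace ℝ (Fin 3) → EuclideanSpace ℝ (Fin 3) :=
    fun n x => ((n : ℝ) + 1)⁻¹ • ψ (((n : ℝ) + 1) • U x)
  have hc : ∀ n : ℕ, (0 : ℝ) < n + 1 := fun n => by positivity
  have h1 : ∀ n, ContDiff ℝ 1 (un n) := fun n =>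
    (hψ.comp (hU.const_smul ((n : ℝ) + 1))).const_smul ((n : ℝ) + 1)⁻¹
  -- compact support of the truncations: `ψ((n+1) U x) = 0` once `‖U x‖ ≤ (n+1)⁻¹`
  have hcs : ∀ n, HasCompactSupport (un n) := fun n => by
    have hev : ∀ᶠ x in cocompact (EuclideanSpace ℝ (Fin 3)), ‖U x‖ < ((n : ℝ) + 1)⁻¹ := by
      have := hU0.norm
      rw [norm_zero] at this
      exact (tendsto_order.1 this).2 _ (inv_pos.2 (hc n))
    obtain ⟨t, ht, hts⟩ := mem_cocompact.1 hev
    refine HasCompactSupport.intro ht fun x hx => ?_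
    have hx' : ‖U x‖ < ((n : ℝ) + 1)⁻¹ := hts hx
    have hsm : ‖((n : ℝ) + 1) • U x‖ ≤ 1 := by
      rw [norm_smul, Real.norm_of_nonneg (hc n).le]
      have := mul_lt_mul_of_pos_left hx' (hc n)
      rw [mul_inv_cancel₀ (hc n).ne'] at this
      exact this.le
    simp only [un, hψ0 _ hsm, smul_zero]
  have h2 : ∀ n, eLpNorm (un n) 2 volume < ⊤ := fun n =>
    ((h1 n).continuous.memLp_of_hasCompactSupport (hcs n)).eLpNorm_lt_top
  have h3 : ∀ n, eLpNorm (fderiv ℝ (un n)) 2 volume ≤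
      ENNReal.ofReal L * eLpNorm (fderiv ℝ U) 2 volume := fun n =>
    eLpNorm_le_mul_eLpNorm_of_ae_le_mul (Eventually.of_forall fun x =>
      SobolevSix.norm_fderiv_rescaled_comp_le hψ hDψ hU (hc n) x) 2
  have hGNS : ∀ n, eLpNorm (un n) 6 volume ≤
      K₀ * (ENNReal.ofReal L * eLpNorm (fderiv ℝ U) 2 volume) := fun n =>
    (eLpNorm_six_le_eLpNorm_fderiv_two volume finrank_euclideanSpace_fin (h1 n) (h2 n)).trans
      (by rw [← hK₀]; gcongr; exact h3 n)
  have hlim : ∀ x, Tendsto (fun n => un n x) atTop (𝓝 (U x)) := fun x =>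
    SobolevSix.tendsto_rescaled_comp hψ3 hψid U x
  have hFatou : eLpNorm U 6 volume ≤ atTop.liminf fun n => eLpNorm (un n) 6 volume :=
    Lp.eLpNorm_lim_le_liminf_eLpNorm (fun n => (h1 n).continuous.aestronglyMeasurable) U
      (Eventually.of_forall hlim)
  calc eLpNorm U 6 volume ≤ atTop.liminf fun n => eLpNorm (un n) 6 volume := hFatou
    _ ≤ K₀ * (ENNReal.ofReal L * eLpNorm (fderiv ℝ U) 2 volume) :=
        liminf_le_of_frequently_le' (Frequently.of_forall hGNS)
    _ = ((K₀ * L.toNNReal : ℝ≥0) : ℝ≥0∞) * eLpNorm (fderiv ℝ U) 2 volume := by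
        rw [ENNReal.coe_mul, mul_assoc]
        rfl
    _ ≤ ((K₀ * L.toNNReal : ℝ≥0) : ℝ≥0∞) *
        (∫⁻ y, ENNReal.ofReal (frobeniusNormSq (fderiv ℝ U y))) ^ (1 / 2 : ℝ) := by
        gcongr
        exact SobolevSix.eLpNorm_fderiv_two_le_lintegral_frobeniusNormSq volume U

/-- A `C¹` field on `ℝ³` tending to `0` at infinity with finite Dirichlet integral is in `L⁶`
(Galdi 2011, Thm. II.6.1, smooth case). -/
theorem memLp_six_of_tendsto_cocompact {U : EuclideanSpace ℝ (Fin 3) → EuclideanSpace ℝ (Fin 3)}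
    (hU : ContDiff ℝ 1 U) (hU0 : Tendsto U (cocompact (EuclideanSpace ℝ (Fin 3))) (𝓝 0))
    (hD : (∫⁻ y, ENNReal.ofReal (frobeniusNormSq (fderiv ℝ U y))) < ⊤) :
    MemLp U 6 volume := by
  obtain ⟨K, hK⟩ := eLpNorm_six_le_of_tendsto_cocompact
  refine ⟨hU.continuous.aestronglyMeasurable, (hK U hU hU0).trans_lt ?_⟩
  exact ENNReal.mul_lt_top ENNReal.coe_lt_top
    (ENNReal.rpow_lt_top_of_nonneg (by norm_num) hD.ne)

/-! ### Smooth steady solutions with `ν = 1` lie in the class of X2 -/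

/-- A Leray profile at rate `a = 0` is a steady Navier–Stokes solution with zero force (the two
structures agree field for field once the `a`-terms vanish). -/
theorem isSteadyNSSolution_of_isLerayProfile_zero {ν : ℝ}
    {U : EuclideanSpace ℝ (Fin 3) → EuclideanSpace ℝ (Fin 3)} {P : EuclideanSpace ℝ (Fin 3) → ℝ}
    (h : IsLerayProfile ν 0 U P) : IsSteadyNSSolution ν 0 U P where
  contDiff_velocity := h.contDiff_velocity
  contDiff_pressure := h.contDiff_pressure
  momentum y := by
    have := h.profile_eq y
    simpa only [zero_smul, add_zero, Pi.zero_apply] using this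
  divFree := h.divFree

/-- The time-independent extension `(fun _ => U, fun _ => P)` of a smooth steady solution with
zero force is a classical Navier–Stokes solution on every time set (the time derivative of a
constant field vanishes). -/
theorem isClassicalNSSolutionOn_const {ν : ℝ}
    {U : EuclideanSpace ℝ (Fin 3) → EuclideanSpace ℝ (Fin 3)} {P : EuclideanSpace ℝ (Fin 3) → ℝ}
    (h : IsSteadyNSSolution ν 0 U P) (hU : ContDiff ℝ (⊤ : ℕ∞) U) (hP : ContDiff ℝ (⊤ : ℕ∞) P)
    (S : Set ℝ) : IsClassicalNSSolutionOn S ν 0 (fun _ => U) (fun _ => P) where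
  smooth_velocity := (hU.comp contDiff_snd).contDiffOn
  smooth_pressure := (hP.comp contDiff_snd).contDiffOn
  momentum t ht y := by
    have hm := h.momentum y
    simp only [timeDerivWithin_apply, derivWithin_fun_const, Pi.zero_apply, add_zero,
      zero_add] at hm ⊢
    rw [← sub_eq_zero, ← hm]
    abel
  divFree t ht := h.divFree

/-- **Steady solutions are in the class of X2.** A smooth steady solution `(W, Q)` of
Navier–Stokes with `ν = 1` and zero force, with finite Dirichlet integral and `W → 0` at
infinity, viewed as the time-independent field `fun _ => W` on `(−∞,0) × ℝ³`, is a bounded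
ancient mild solution (tree bridge `isBoundedAncientMildSolution_of_classical_bounded`; bounded
because continuous and tending to `0`), smooth on `(−∞,0) × ℝ³`, of uniformly bounded (constant)
enstrophy, with `L⁶` slices (`memLp_six_of_tendsto_cocompact`). -/
theorem steady_hypotheses
    {W : EuclideanSpace ℝ (Fin 3) → EuclideanSpace ℝ (Fin 3)} {Q : EuclideanSpace ℝ (Fin 3) → ℝ}
    (h : IsSteadyNSSolution 1 0 W Q) (hW : ContDiff ℝ (⊤ : ℕ∞) W) (hQ : ContDiff ℝ (⊤ : ℕ∞) Q)
    (hD : (∫⁻ y, ENNReal.ofReal (frobeniusNormSq (fderiv ℝ W y))) < ⊤)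
    (h0 : Tendsto W (cocompact (EuclideanSpace ℝ (Fin 3))) (𝓝 0)) :
    IsBoundedAncientMildSolution 1 (fun _ : ℝ => W) ∧
    ContDiffOn ℝ (⊤ : ℕ∞) (Function.uncurry fun _ : ℝ => W) (Set.Iio 0 ×ˢ Set.univ) ∧
    (∃ C : NNReal, ∀ s < (0 : ℝ), ∫⁻ y, ENNReal.ofReal
        (frobeniusNormSq (fderiv ℝ ((fun _ : ℝ => W) s) y)) ≤ C) ∧
    (∀ s < (0 : ℝ), MemLp ((fun _ : ℝ => W) s) 6 volume) := by
  have hcl := isClassicalNSSolutionOn_const h hW hQ (Iio 0)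
  obtain ⟨C, hC⟩ := exists_norm_le_of_tendsto_cocompact hW.continuous h0
  refine ⟨?_, (hW.comp contDiff_snd).contDiffOn, ?_, fun _ _ => ?_⟩
  · exact FrequencyRigidity.TwoEndedPinning.isBoundedAncientMildSolution_of_classical_bounded hcl
      (fun _ _ x => hC x)
  · refine ⟨(∫⁻ y, ENNReal.ofReal (frobeniusNormSq (fderiv ℝ W y))).toNNReal, fun _ _ => ?_⟩
    rw [ENNReal.coe_toNNReal hD.ne]
  · exact memLp_six_of_tendsto_cocompact (hW.of_le (by exact_mod_cast le_top)) h0 hD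

/-- **Viscosity normalisation of the data of `GaldiLiouville`.** From a smooth Leray profile
`(U, P)` at rate `0` with viscosity `ν > 0`, finite Dirichlet integral and `U → 0`: the fields
`W = ν⁻¹ U`, `Q = ν⁻² P` form a smooth steady solution with `ν = 1`, finite Dirichlet integral
(`|∇W|_F² = ν⁻² |∇U|_F²`) and `W → 0`. -/
theorem normalise {ν : ℝ} (hν : 0 < ν)
    {U : EuclideanSpace ℝ (Fin 3) → EuclideanSpace ℝ (Fin 3)} {P : EuclideanSpace ℝ (Fin 3) → ℝ}
    (hprof : IsLerayProfile ν 0 U P) (hU : ContDiff ℝ (⊤ : ℕ∞) U) (hP : ContDiff ℝ (⊤ : ℕ∞) P)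
    (hD : (∫⁻ y, ENNReal.ofReal (frobeniusNormSq (fderiv ℝ U y))) < ⊤)
    (h0 : Tendsto U (cocompact (EuclideanSpace ℝ (Fin 3))) (𝓝 0)) :
    IsSteadyNSSolution 1 0 (ν⁻¹ • U) (ν⁻¹ ^ 2 • P) ∧ ContDiff ℝ (⊤ : ℕ∞) (ν⁻¹ • U) ∧
    ContDiff ℝ (⊤ : ℕ∞) (ν⁻¹ ^ 2 • P) ∧
    (∫⁻ y, ENNReal.ofReal (frobeniusNormSq (fderiv ℝ (ν⁻¹ • U) y))) < ⊤ ∧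
    Tendsto (ν⁻¹ • U) (cocompact (EuclideanSpace ℝ (Fin 3))) (𝓝 0) := by
  have hst : IsSteadyNSSolution 1 0 (ν⁻¹ • U) (ν⁻¹ ^ 2 • P) := by
    have := (isSteadyNSSolution_of_isLerayProfile_zero hprof).viscosity_one hν.ne'
    simpa only [smul_zero] using this
  refine ⟨hst, hU.const_smul ν⁻¹, hP.const_smul (ν⁻¹ ^ 2), ?_, ?_⟩
  · have hderiv : ∀ y, fderiv ℝ (ν⁻¹ • U) y = ν⁻¹ • fderiv ℝ U y := fun y =>
      fderiv_const_smul ((hU.differentiable (by simp)) y) ν⁻¹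
    have hfrob : ∀ y, frobeniusNormSq (fderiv ℝ (ν⁻¹ • U) y) =
        ν⁻¹ ^ 2 * frobeniusNormSq (fderiv ℝ U y) := fun y => by
      rw [hderiv]
      unfold frobeniusNormSq
      rw [Finset.mul_sum]
      refine Finset.sum_congr rfl fun i _ => ?_
      rw [show (ν⁻¹ • fderiv ℝ U y) (stdOrthonormalBasis ℝ (EuclideanSpace ℝ (Fin 3)) i) =
          ν⁻¹ • fderiv ℝ U y (stdOrthonormalBasis ℝ (EuclideanSpace ℝ (Fin 3)) i) from rfl,
        norm_smul, mul_pow, Real.norm_eq_abs, sq_abs]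
    simp_rw [hfrob, ENNReal.ofReal_mul (sq_nonneg _)]
    rw [lintegral_const_mul' _ _ ENNReal.ofReal_ne_top]
    exact ENNReal.mul_lt_top ENNReal.ofReal_lt_top hD
  · have := h0.const_smul ν⁻¹
    rwa [smul_zero] at this

/-- From `ν⁻¹ • U = 0` (pointwise) back to `U = 0`. -/
theorem eq_zero_of_inv_smul_eq_zero {ν : ℝ} (hν : 0 < ν)
    {U : EuclideanSpace ℝ (Fin 3) → EuclideanSpace ℝ (Fin 3)} (h : ∀ y, (ν⁻¹ • U) y = 0) :
    U = 0 := by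
  funext y
  have hy := h y
  rw [Pi.smul_apply, smul_eq_zero] at hy
  rcases hy with hy | hy
  · exact absurd hy (inv_ne_zero hν.ne')
  · simpa using hy

end Tightness

/-! ### The two containments -/

/-- **X2 contains Galdi's Liouville problem: `ParabolicGaldiLiouville → GaldiLiouville`.** Given a
smooth Leray profile `(U, P)` at rate `0` (a steady solution) with viscosity `ν > 0`, finite
Dirichlet integral and `U → 0` at infinity, normalise the viscosity (`W = ν⁻¹U`); the
time-independent field `fun _ => W` satisfies every hypothesis of X2
(`Tightness.steady_hypotheses`), so X2 gives `W(−1, ·) = W ≡ 0`, hence `U = 0`. This is the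
route's containment "crux 0893 ⊇ crux 0895" (Galdi 2011, Rem. X.9.4: Leray's problem), now in
Lean: closing `ParabolicGaldiLiouville` closes `GaldiLiouville`. -/
theorem galdiLiouville_of_parabolicGaldiLiouville
    (hX2 : Theses.GaldiLiouvilleGate.ParabolicGaldiLiouville) :
    Theses.GaldiLiouvilleGate.GaldiLiouville := by
  intro ν hν U P hprof hU hP hD h0
  obtain ⟨hst, hW, hQ, hDW, h0W⟩ := Tightness.normalise hν hprof hU hP hD h0
  obtain ⟨h1, h2, h3, h4⟩ := Tightness.steady_hypotheses hst hW hQ hDW h0W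
  exact Tightness.eq_zero_of_inv_smul_eq_zero hν
    (hX2 (fun _ => ν⁻¹ • U) h1 h2 h3 h4 (-1) (by norm_num))

/-- **The open stub of the line also contains Galdi's problem:
`stub_finiteDissipation → GaldiLiouville`.** With `W = ν⁻¹U` as above, the stub applied to the
time-independent field `fun _ => W` says `∫_{s<0} (∫ |∇W|_F²) ds < ∞`; the inner integral does not
depend on `s` and `volume (Iio 0) = ∞`, so `∫ |∇W|_F² = 0`; by continuity `|∇W(y)|_F = 0`, hence
`DW ≡ 0` (`‖L‖² ≤ |L|_F²`), `W` is constant (`is_const_of_fderiv_eq_zero`), and a constant tending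
to `0` at infinity is `0`. So any proof of the stub is, in particular, a solution of Leray's
Liouville problem for `D`-solutions (crux 0895). -/
theorem galdiLiouville_of_finiteDissipation
    (hstub : ∀ v : ℝ → EuclideanSpace ℝ (Fin 3) → EuclideanSpace ℝ (Fin 3),
      Literature.Analysis.FluidPDE.IsBoundedAncientMildSolution 1 v →
      ContDiffOn ℝ (⊤ : ℕ∞) (Function.uncurry v) (Set.Iio 0 ×ˢ Set.univ) →
      (∃ C : NNReal, ∀ s < 0, ∫⁻ y, ENNReal.ofReal
          (Literature.Analysis.FluidPDE.frobeniusNormSq (fderiv ℝ (v s) y)) ≤ C) →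
      (∀ s < 0, MeasureTheory.MemLp (v s) 6 MeasureTheory.volume) →
      (∫⁻ s in Set.Iio 0, ∫⁻ y, ENNReal.ofReal
          (Literature.Analysis.FluidPDE.frobeniusNormSq (fderiv ℝ (v s) y))) < ⊤) :
    Theses.GaldiLiouvilleGate.GaldiLiouville := by
  intro ν hν U P hprof hU hP hD h0
  obtain ⟨hst, hW, hQ, hDW, h0W⟩ := Tightness.normalise hν hprof hU hP hD h0
  obtain ⟨h1, h2, h3, h4⟩ := Tightness.steady_hypotheses hst hW hQ hDW h0W
  set W : EuclideanSpace ℝ (Fin 3) → EuclideanSpace ℝ (Fin 3) := ν⁻¹ • U with hWdef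
  have hfin := hstub (fun _ => W) h1 h2 h3 h4
  -- the inner integral is constant in `s` and `volume (Iio 0) = ∞`, so it vanishes
  set D : ℝ≥0∞ := ∫⁻ y, ENNReal.ofReal (frobeniusNormSq (fderiv ℝ W y)) with hDdef
  have hfin' : D * volume (Iio (0 : ℝ)) < ⊤ := by
    rw [← setLIntegral_const]
    exact hfin
  rw [Real.volume_Iio] at hfin'
  have hD0 : D = 0 := by
    by_contra hne
    rw [ENNReal.mul_top hne] at hfin'
    exact lt_irrefl _ hfin'
  -- hence `|∇W|_F² = 0` everywhere (continuity), so `DW ≡ 0`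
  have hW1 : ContDiff ℝ 1 W := hW.of_le (by exact_mod_cast le_top)
  have hcont : Continuous fun y => ENNReal.ofReal (frobeniusNormSq (fderiv ℝ W y)) :=
    ENNReal.continuous_ofReal.comp (continuous_frobeniusNormSq_fderiv hW1 one_ne_zero)
  have hae : (fun y => ENNReal.ofReal (frobeniusNormSq (fderiv ℝ W y))) =ᵐ[volume] 0 :=
    (lintegral_eq_zero_iff hcont.measurable).1 hD0
  have hall : (fun y => ENNReal.ofReal (frobeniusNormSq (fderiv ℝ W y))) = fun _ => 0 :=
    (Continuous.ae_eq_iff_eq volume hcont continuous_const).1 hae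
  have hfd : ∀ y, fderiv ℝ W y = 0 := fun y => by
    have hy := congrFun hall y
    simp only [ENNReal.ofReal_eq_zero] at hy
    have hsq : ‖fderiv ℝ W y‖ ^ 2 ≤ 0 := (sq_opNorm_le_frobeniusNormSq _).trans hy
    have hn : ‖fderiv ℝ W y‖ = 0 := by nlinarith [norm_nonneg (fderiv ℝ W y)]
    exact norm_eq_zero.1 hn
  -- `W` is constant and tends to `0`, so `W = 0`
  have hconst : ∀ y, W y = W 0 := fun y =>
    is_const_of_fderiv_eq_zero (hW1.differentiable one_ne_zero) hfd y 0
  have hW0 : W 0 = 0 := by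
    have hc : Tendsto (fun _ : EuclideanSpace ℝ (Fin 3) => W 0)
        (cocompact (EuclideanSpace ℝ (Fin 3))) (𝓝 0) :=
      h0W.congr (fun y => hconst y)
    exact tendsto_const_nhds_iff.1 hc
  exact Tightness.eq_zero_of_inv_smul_eq_zero hν (fun y => by rw [← hWdef, hconst y, hW0])

end Summit.NavierStokesRegularity.NavierStokesRegularity.Theorems.ParabolicGaldiLiouville.Birth

end
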